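import Summits.CriticalPhenomena.PercolationContinuityZ3.Theorems.PercNearOneGluingNoHeavyQuantFlowAtTMonotone
import Summits.CriticalPhenomena.PercolationContinuityZ3.Theorems.PercNearOneGluingNoHeavyQuantDECAtTMixtures
import Summits.CriticalPhenomena.PercolationContinuityZ3.Theorems.PercNearOneGluingNoHeavyQuantGatedShiftDECHolds
import HarnessLib

/-!
# QUANT lane R8, T-DEC, the q < 1 slice of `SingleGateConvClosed`: the POINT PIECES of the single-gate reassembly are DEC
# UNCONDITIONALLY, for a GENERAL second factor — a shifted copy `μ₂(· − k)` of the second factor hung under a self-sufficient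
# point `k` of the first factor's datum is `DECAtT` at the global target (`LawDec.decAtT_shiftedFactor`); de-gating is free

builds on p205010 (kernel theorem, internal audit signed; external expert review pending)

Support file (`--supports stmt-CriticalPhenomena-4575`), QUANT lane seat prim-quant-arm-2 (gen 33), rung R8 of
`run/shared/lean/prim/quant/LADDER.md`; memos `run/shared/lean/prim/quant/FOR-PROVERS-SINGLE-GATE.md` §5 (piece / budget anatomy of the
q < 1 slice, "arm-2: cells") and `run/shared/lean/prim/quant/prim-quant-arm-2-g32/SGC-PIECES-G32.md` §0 (5a), §4 (K).  Theorems only (no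
definitions), standard axioms, no sorries.

WHY.  In pconv form the q < 1 slice of `LawDec.SingleGateConvClosed` (lead g28, `…QuantSingleGateClosure`) splits `gate_q(μ₁ ∗ μ₂)` over a DEC
datum `gate_q μ₁ = Σ λ_i C_i` into pieces (lead g28 `…QuantSingleGatePieces`, `gateConv_eq_pieces`): zero-components `{0, h; γ} ↦ (1−γ)δ₀ +
γ·μ₂(·−h)`, pairs `{l, h; γ′}` ↦ `C ∗ μ₂`, and POINTS `k ↦ μ₂(· − k)`.  Arm-2 g32's exact census of the anatomy for a two-point second factor found
the point pieces standalone-DEC in 1 340 879 / 1 340 879 instances (the zero pieces are the content; the pair pieces are leg (II)'s).  This file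
PROVES the point pieces DEC, for an ARBITRARY second factor `μ₂`, from the single-gate hypothesis on `μ₂` alone:

* **`LawDec.decAtT_shiftedFactor`** — `0 < y < 1`, `0 < q ≤ 1`, `μ₂` a probability law on `{0..M₂}` whose gated version `gate μ₂ q` is
  top-affordable (`y·M₂ ≤ q·T₂`, `T₂` the mean of `μ₂`) and DEC at every layer `j′ < M₂` at floor `y` (exactly the hypotheses of
  `SingleGateConvClosed` on the second factor), a shift `k` and a target `T` with **`T ≤ 2k + q·T₂` or `j < k`**: then the shifted law
  `h ↦ μ₂(h − k)·[k ≤ h]` is `DECAtT y T j (M₂ + k)`.  In the reassembly `T = q·T₁ + q·T₂` and `k` is a point component of the datum of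
  `ν = gate_q μ₁` at the working layer `min(j, M₁−1)`, i.e. `2k ≥ q·T₁` (then `T ≤ 2k + q·T₂`) or `k` above the working layer (then `j < k`,
  or `k = M₁` and again `2k ≥ 2T₁ ≥ q·T₁`) — `LawDec.pointPiece_decAtT` below packages this.
* PROOF = three law-level tools, two of them already in the tree: (1) **de-gating is free at a fixed target** — `LawDec.decAtT_of_decAtT_gate`:
  `DECAtT x T j′ M (gate μ q) → DECAtT x T j′ M μ` (`0 < q ≤ 1`; the flow of the gated law scaled by `1/q` ships every low of `μ` and overloads no
  absorber — typer g23's `FlowAtT.smul` / `FlowAtT.mono_law`); (2) census-2 g56's shift lemma with the double target bonus `decAtT_shift_two`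
  (`T ↦ T + 2k`, layer `↦ + k`); (3) census-2 g53's `decAtT_antitone_target`.  The hypothesis at layers `≥ M₂` is Theorem A (`decAt_of_top_le`):
  `LawDec.decAtT_gate_allLayers`.  For `j < k` every charged atom is a giant (`flowAtT_of_noLow`).
* `LawDec.lconv_point_left_of_le` — `lconv M₁ M₂ δ_k μ₂ = μ₂(· − k)·[k ≤ ·]` (`k ≤ M₁`; typer g25's `lconv_point_left` is `M₁ = k`); **`LawDec.pointPiece_decAtT`** — the point piece of
  `gateConv_eq_pieces` (component `C = δ_k`, `1 ≤ k ≤ M₁`, zero budget `0`, normaliser `1`) is `DECAtT y (q·T₁ + q·T₂) j M′` for every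
  `M′ ≥ M₁ + M₂` as soon as `k` is a valid point of `ν`'s datum at layer `min(j, M₁ − 1)` (`q·T₁ ≤ 2k ∨ min(j, M₁−1) + 1 ≤ k`).
So of the three piece types of the q < 1 slice, the point pieces need no cell and no budget; what remains is the zero pieces with ONE zero budget
(FOR-PROVERS-SINGLE-GATE §5 (ii)) and the (II)-type pair pieces.  HONEST STATUS: `SingleGateConvClosed` and both of its slices remain OPEN; the RATE
class log\* and the honest sentence of `run/shared/lean/prim/quant/README.md` are unchanged.

[this work]; flow normal form / monotonicity: prim-quant-stmt g22/g23; shift lemma, mixtures: prim-quant-census-2 g53/g56; reassembly: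
prim-quant-lead g28 (this lane).  Nothing here is cited as a published result.  The gluing rows served [cite: KozmaNitzan2024, Conjecture 3 (p. 15)];
product measure [cite: Grimmett1999, §1.3 p. 10].
-/

noncomputable section

namespace Summit.CriticalPhenomena.PercolationContinuityZ3.Theorems

namespace Quant

open Finset

namespace LawDec

/-! ### Two small tools: no charged low atom; de-gating at a fixed target -/

/-- **a law with no charged low atom has the empty flow**: if every low atom `l ≤ j′`, `2l < T` has `μ l = 0` and `μ ≥ 0`, then
`FlowAtT x T j′ M μ`. [this work] -/
theorem flowAtT_of_noLow (x T : ℝ) (j' M : ℕ) (μ : ℕ → ℝ) (hμ0 : ∀ h, 0 ≤ μ h)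
    (hno : ∀ l, l ≤ j' → 2 * (l : ℝ) < T → μ l = 0) : FlowAtT x T j' M μ := by
  refine ⟨fun _ _ => 0, fun _ _ => le_rfl, fun l h hpos => absurd hpos (lt_irrefl 0), fun l hlj hlow => ?_, fun h _ _ => ?_⟩
  · rw [Finset.sum_const_zero, hno l hlj hlow]
  · simp only [mul_zero, Finset.sum_const_zero]
    exact hμ0 h

/-- **DE-GATING IS FREE AT A FIXED TARGET.**  `0 < x < 1`, `0 < q ≤ 1`, `μ` a probability law on `{0..M}`: if the gated law
`gate μ q = (1−q)δ₀ + q·μ` is `DECAtT x T j′ M` then so is `μ` (same target, layer, top).  The flow of the gated law scaled by `1/q` ships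
`μ l` out of every low `l ≥ 1` and `μ 0 + (1−q)/q ≥ μ 0` out of `0`, and loads every absorber `h ≥ 1` by at most `μ h`; `0` is an absorber
only when `T ≤ 0`, and then there is no low atom at all. [this work] -/
theorem decAtT_of_decAtT_gate (x T q : ℝ) (j' M : ℕ) (μ : ℕ → ℝ) (hx0 : 0 < x) (hx1 : x < 1) (hq0 : 0 < q) (hq1 : q ≤ 1)
    (hμ0 : ∀ h, 0 ≤ μ h) (hμM : ∀ h, M < h → μ h = 0) (hμ1 : ∑ h ∈ Finset.range (M + 1), μ h = 1)
    (hdec : DECAtT x T j' M (gate μ q)) : DECAtT x T j' M μ := by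
  refine decAtT_of_flowAtT x T j' M μ hx0 hx1 hμM hμ1 ?_
  by_cases hT : T ≤ 0
  · refine flowAtT_of_noLow x T j' M μ hμ0 fun l _ hlow => ?_
    exfalso
    have : (0 : ℝ) ≤ l := Nat.cast_nonneg l
    linarith
  · push Not at hT
    have hF := (flowAtT_of_decAtT x T j' M (gate μ q) hx0 hx1 hdec).smul (1 / q) (by positivity)
    refine hF.mono_law hx0 hx1 (fun l _ _ => ⟨hμ0 l, ?_⟩) (fun h _ habs => ?_)
    · show μ l ≤ 1 / q * gate μ q l
      rw [gate_apply]
      have hz : 0 ≤ (1 - q) * (if l = 0 then (1 : ℝ) else 0) :=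
        mul_nonneg (by linarith) (by split_ifs <;> norm_num)
      calc μ l = 1 / q * (q * μ l) := by field_simp
        _ ≤ 1 / q * (q * μ l + (1 - q) * (if l = 0 then (1 : ℝ) else 0)) :=
          mul_le_mul_of_nonneg_left (by linarith) (by positivity)
    · show 1 / q * gate μ q h ≤ μ h
      have hh : h ≠ 0 := by
        rintro rfl
        rcases habs with h1 | h2
        · omega
        · simp only [Nat.cast_zero, mul_zero] at h2
          linarith
      rw [gate_apply, if_neg hh, mul_zero, add_zero, ← mul_assoc, one_div_mul_cancel hq0.ne', one_mul]

/-! ### The single-gate hypothesis on the second factor, at every layer -/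

/-- **the gated second factor is DEC at EVERY layer at its mean `q·T₂`**: below the top by hypothesis, at and above the top by Theorem A
(`decAt_of_top_le`, the gated law being top-affordable). [this work] -/
theorem decAtT_gate_allLayers (y q : ℝ) (M₂ : ℕ) (μ₂ : ℕ → ℝ) (hy0 : 0 < y) (hy1 : y < 1) (hq0 : 0 < q) (hq1 : q ≤ 1)
    (hμ0 : ∀ h, 0 ≤ μ₂ h) (hμM : ∀ h, M₂ < h → μ₂ h = 0) (hμ1 : ∑ h ∈ Finset.range (M₂ + 1), μ₂ h = 1)
    (hta : y * (M₂ : ℝ) ≤ q * ∑ h ∈ Finset.range (M₂ + 1), (h : ℝ) * μ₂ h)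
    (hdec : ∀ j', j' < M₂ → DECAt y j' M₂ (gate μ₂ q)) (J : ℕ) :
    DECAtT y (q * ∑ h ∈ Finset.range (M₂ + 1), (h : ℝ) * μ₂ h) J M₂ (gate μ₂ q) := by
  obtain ⟨hν0, hνM, hν1⟩ := gate_laws M₂ μ₂ q hq0.le hq1 hμ0 hμM hμ1
  have hνmean : ∑ h ∈ Finset.range (M₂ + 1), (h : ℝ) * gate μ₂ q h = q * ∑ h ∈ Finset.range (M₂ + 1), (h : ℝ) * μ₂ h :=
    sum_mul_gate μ₂ q M₂
  rw [← hνmean, ← decAt_iff_decAtT]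
  by_cases hJM : J < M₂
  · exact hdec J hJM
  · refine decAt_of_top_le M₂ (gate μ₂ q) hν0 hνM hν1 y hy1 (fun h hh => ?_) J (by omega)
    rw [hνmean]
    have hhM : (h : ℝ) ≤ M₂ := by
      have : h ≤ M₂ := by
        by_contra hc
        exact hh.ne' (hνM h (by omega))
      exact_mod_cast this
    nlinarith

/-! ### The point piece: a shifted copy of the second factor -/

/-- **THE SHIFTED SECOND FACTOR IS DEC AT THE GLOBAL TARGET (general second factor).**  `0 < y < 1`, `0 < q ≤ 1`; `μ₂` a probability law on
`{0..M₂}` with mean `T₂` whose gated version `gate μ₂ q` is top-affordable at `y` (`y·M₂ ≤ q·T₂`) and DEC at every layer `j′ < M₂` at floor `y`;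
a shift `k` and a target `T` with `j < k` or `T ≤ 2k + q·T₂`.  Then `h ↦ μ₂(h − k)·[k ≤ h]` is `DECAtT y T j (M₂ + k)`.
Proof: for `j < k` every charged atom is a giant (empty flow); for `j = J + k` de-gate the hypothesis at layer `J` (`decAtT_of_decAtT_gate`,
with `decAtT_gate_allLayers`), shift it by `k` with the double target bonus (`decAtT_shift_two`: target `q·T₂ + 2k`, layer `J + k`) and lower the
target (`decAtT_antitone_target`). [this work] -/
theorem decAtT_shiftedFactor (y q T : ℝ) (j k M₂ : ℕ) (μ₂ : ℕ → ℝ)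
    (hy0 : 0 < y) (hy1 : y < 1) (hq0 : 0 < q) (hq1 : q ≤ 1)
    (hμ0 : ∀ h, 0 ≤ μ₂ h) (hμM : ∀ h, M₂ < h → μ₂ h = 0) (hμ1 : ∑ h ∈ Finset.range (M₂ + 1), μ₂ h = 1)
    (hta : y * (M₂ : ℝ) ≤ q * ∑ h ∈ Finset.range (M₂ + 1), (h : ℝ) * μ₂ h)
    (hdec : ∀ j', j' < M₂ → DECAt y j' M₂ (gate μ₂ q))
    (hT : j < k ∨ T ≤ 2 * (k : ℝ) + q * ∑ h ∈ Finset.range (M₂ + 1), (h : ℝ) * μ₂ h) :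
    DECAtT y T j (M₂ + k) (fun h => if k ≤ h then μ₂ (h - k) else 0) := by
  by_cases hjk : j < k
  · -- every charged atom `h ≥ k > j` is a giant: the empty flow
    obtain ⟨hL0, hLM, hL1, -⟩ := shift_laws k M₂ μ₂ hμ0 hμM hμ1
    have e : k + M₂ = M₂ + k := Nat.add_comm k M₂
    rw [e] at hLM hL1
    refine decAtT_of_flowAtT y T j (M₂ + k) _ hy0 hy1 hLM hL1 (flowAtT_of_noLow y T j (M₂ + k) _ hL0 fun l hlj _ => ?_)
    show (if k ≤ l then μ₂ (l - k) else 0) = 0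
    rw [if_neg (by omega)]
  · push Not at hjk
    have hT' : T ≤ 2 * (k : ℝ) + q * ∑ h ∈ Finset.range (M₂ + 1), (h : ℝ) * μ₂ h := by
      rcases hT with h1 | h2
      · exact absurd h1 (by omega)
      · exact h2
    obtain ⟨J, rfl⟩ := Nat.exists_eq_add_of_le hjk
    have h1 : DECAtT y (q * ∑ h ∈ Finset.range (M₂ + 1), (h : ℝ) * μ₂ h) J M₂ μ₂ :=
      decAtT_of_decAtT_gate y _ q J M₂ μ₂ hy0 hy1 hq0 hq1 hμ0 hμM hμ1
        (decAtT_gate_allLayers y q M₂ μ₂ hy0 hy1 hq0 hq1 hμ0 hμM hμ1 hta hdec J)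
    have h2 := decAtT_shift_two y (q * ∑ h ∈ Finset.range (M₂ + 1), (h : ℝ) * μ₂ h) J M₂ k μ₂ h1
    rw [Nat.add_comm k J]
    exact decAtT_antitone_target (by linarith) h2

/-! ### The point piece in the shape of the reassembly `gateConv_eq_pieces` -/

/-- `lconv` against the indicator of one atom `k ≤ M₁` is the shift by `k`: `lconv M₁ M₂ δ_k μ₂ = μ₂(· − k)·[k ≤ ·]`
(`μ₂` vanishing above `M₂`; the case `M₁ = k` is `lconv_point_left` of `…QuantGatedConvCone`). [this work] -/
theorem lconv_point_left_of_le (M₁ M₂ k : ℕ) (μ₂ : ℕ → ℝ) (hk : k ≤ M₁) (hμM : ∀ h, M₂ < h → μ₂ h = 0) (h : ℕ) :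
    lconv M₁ M₂ (fun i => if i = k then (1 : ℝ) else 0) μ₂ h = if k ≤ h then μ₂ (h - k) else 0 := by
  simp only [lconv]
  rw [Finset.sum_eq_single_of_mem k (Finset.mem_range.2 (by omega)) (fun i _ hik => ?_)]
  · simp only [if_true, one_mul]
    by_cases hkh : k ≤ h
    · rw [if_pos hkh]
      by_cases hs : h - k ≤ M₂
      · rw [Finset.sum_eq_single_of_mem (h - k) (Finset.mem_range.2 (by omega)) (fun s _ hs' => if_neg (by omega)),
          if_pos (by omega)]
      · rw [hμM (h - k) (by omega)]
        exact Finset.sum_eq_zero fun s hs' => if_neg (by have := Finset.mem_range.1 hs'; omega)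
    · rw [if_neg hkh]
      exact Finset.sum_eq_zero fun s _ => if_neg (by omega)
  · refine Finset.sum_eq_zero fun s _ => ?_
    rw [if_neg hik, zero_mul]
    split_ifs <;> rfl

/-- **THE POINT PIECE OF THE SINGLE-GATE REASSEMBLY IS DEC.**  In the setting of `gateConv_eq_pieces` (lead g28): `0 < y < 1`, `0 < q ≤ 1`,
probability laws `μ₁` on `{0..M₁}` (mean `T₁`) and `μ₂` on `{0..M₂}` (mean `T₂`) with `gate μ₂ q` top-affordable at `y` and DEC at every layer
`j′ < M₂` at floor `y`; a point component `C = δ_k` of a datum of `ν = gate μ₁ q` at the working layer `min(j, M₁ − 1)` — `1 ≤ k ≤ M₁` and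
`q·T₁ ≤ 2k ∨ min(j, M₁−1) + 1 ≤ k` (rule (S) of `ValidAt` at `ν`'s mean `q·T₁`) — with zero budget `0` and normaliser `1`.  Then the piece
`(C 0·[h = 0] + lconv M₁ M₂ (C|_{≥1}) μ₂ h + 0·[h = 0]) / 1` is `DECAtT y (q·T₁ + q·T₂) j M′` for every `M′ ≥ M₁ + M₂`. [this work] -/
theorem pointPiece_decAtT (y q : ℝ) (j k M₁ M₂ M' : ℕ) (μ₁ μ₂ : ℕ → ℝ)
    (hy0 : 0 < y) (hy1 : y < 1) (hq0 : 0 < q) (hq1 : q ≤ 1)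
    (hμ₁0 : ∀ h, 0 ≤ μ₁ h) (hμ₁1 : ∑ h ∈ Finset.range (M₁ + 1), μ₁ h = 1)
    (hμ0 : ∀ h, 0 ≤ μ₂ h) (hμM : ∀ h, M₂ < h → μ₂ h = 0) (hμ1 : ∑ h ∈ Finset.range (M₂ + 1), μ₂ h = 1)
    (hta : y * (M₂ : ℝ) ≤ q * ∑ h ∈ Finset.range (M₂ + 1), (h : ℝ) * μ₂ h)
    (hdec : ∀ j', j' < M₂ → DECAt y j' M₂ (gate μ₂ q))
    (hk1 : 1 ≤ k) (hkM : k ≤ M₁) (hM' : M₁ + M₂ ≤ M')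
    (hvalid : q * ∑ h ∈ Finset.range (M₁ + 1), (h : ℝ) * μ₁ h ≤ 2 * (k : ℝ) ∨ min j (M₁ - 1) + 1 ≤ k) :
    DECAtT y (q * ∑ h ∈ Finset.range (M₁ + 1), (h : ℝ) * μ₁ h + q * ∑ h ∈ Finset.range (M₂ + 1), (h : ℝ) * μ₂ h) j M'
      (fun h => ((if (0 : ℕ) = k then (1 : ℝ) else 0) * (if h = 0 then (1 : ℝ) else 0)
        + lconv M₁ M₂ (fun i => if i = 0 then 0 else (if i = k then (1 : ℝ) else 0)) μ₂ h
        + 0 * (if h = 0 then (1 : ℝ) else 0)) / 1) := by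
  -- the piece is the shifted second factor
  have hk0 : (0 : ℕ) ≠ k := by omega
  have hC : (fun i : ℕ => if i = 0 then (0 : ℝ) else (if i = k then (1 : ℝ) else 0)) = fun i => if i = k then (1 : ℝ) else 0 := by
    funext i
    by_cases hi : i = 0
    · subst hi; rw [if_pos rfl, if_neg hk0]
    · rw [if_neg hi]
  have hpiece : (fun h => ((if (0 : ℕ) = k then (1 : ℝ) else 0) * (if h = 0 then (1 : ℝ) else 0)
        + lconv M₁ M₂ (fun i => if i = 0 then 0 else (if i = k then (1 : ℝ) else 0)) μ₂ h
        + 0 * (if h = 0 then (1 : ℝ) else 0)) / 1) = fun h => if k ≤ h then μ₂ (h - k) else 0 := by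
    funext h
    rw [hC, lconv_point_left_of_le M₁ M₂ k μ₂ hkM hμM h, if_neg hk0]
    ring
  rw [hpiece]
  -- the target is at most `2k + q·T₂`, or `j < k`
  have hmean₁ : ∑ h ∈ Finset.range (M₁ + 1), (h : ℝ) * μ₁ h ≤ (M₁ : ℝ) :=
    (sum_mul_le_top_mul M₁ μ₁ hμ₁0 hμ₁1).trans (by nlinarith [hμ₁0 0, (Nat.cast_nonneg M₁ : (0 : ℝ) ≤ M₁)])
  have hmean₁0 : 0 ≤ ∑ h ∈ Finset.range (M₁ + 1), (h : ℝ) * μ₁ h :=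
    Finset.sum_nonneg fun h _ => mul_nonneg (Nat.cast_nonneg h) (hμ₁0 h)
  have hT : j < k ∨ q * ∑ h ∈ Finset.range (M₁ + 1), (h : ℝ) * μ₁ h + q * ∑ h ∈ Finset.range (M₂ + 1), (h : ℝ) * μ₂ h
      ≤ 2 * (k : ℝ) + q * ∑ h ∈ Finset.range (M₂ + 1), (h : ℝ) * μ₂ h := by
    rcases hvalid with h1 | h2
    · exact Or.inr (by linarith)
    · by_cases hjk : j < k
      · exact Or.inl hjk
      · -- `k` above the working layer but not above `j`: then `j ≥ M₁` and `k = M₁`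
        right
        have hkM₁ : k = M₁ := by
          have : min j (M₁ - 1) = M₁ - 1 := by
            rw [Nat.min_def]; split_ifs with hh
            · omega
            · rfl
          omega
        subst hkM₁
        have : q * ∑ h ∈ Finset.range (k + 1), (h : ℝ) * μ₁ h ≤ 1 * (k : ℝ) := by
          exact mul_le_mul hq1 hmean₁ hmean₁0 zero_le_one
        linarith
  exact decAtT_mono_top (decAtT_shiftedFactor y q _ j k M₂ μ₂ hy0 hy1 hq0 hq1 hμ0 hμM hμ1 hta hdec hT) (by omega)

end LawDec

end Quant

end Summit.CriticalPhenomena.PercolationContinuityZ3.Theorems
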